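import Literature.AnabelianGeometry.EtaleTheta.ContH1
import Mathlib.RepresentationTheory.Homological.GroupCohomology.LowDegree

/-!
# Continuous `H¹` versus discrete `H¹` in degree one

Support file of the abc-iut cell (layer L2, [EtTh]). The tree has two first cohomology groups for
a group acting on an abelian group: the CONTINUOUS one of [EtTh] §1, `ContH1 φ A' H`
(`EtaleTheta/ContH1.lean`: continuous crossed homomorphisms `H → A'` into an abelian normal
subgroup `A' ≤ G'`, `G` acting by conjugation through `φ : G →* G'`, modulo principal ones — "the
[continuous] group cohomology of the tempered fundamental group", PRIMS PDF p. 11,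
[cite: MochizukiEtTh2009, Prop 1.3 p.21]), and Mathlib's DISCRETE `groupCohomology.H1`, in which
the Kummer classes of `EtaleTheta/KummerClass.lean` and `Frobenioids/KummerClass.lean` live. This
file supplies the comparison in degree `1` ([cite: NeukirchSchmidtWingberg2008, I §2 and II §7]):

* `ConjCoeff φ A'` — the coefficient group `A'` as an abstract `G`-module, `G` acting by
  conjugation through `φ` (a type synonym of `↥A'` with this `MulDistribMulAction`);
* `ContH1.toDiscreteH1 : ContH1 φ A' H →* Multiplicative (H1 (Rep.ofMulDistribMulAction H
  (ConjCoeff φ A')))` — forget continuity, `[f] ↦ [f]`;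
* `ContH1.toDiscreteH1_injective` — in degree `1` this is an EMBEDDING: a continuous crossed
  homomorphism that is a discrete coboundary is the principal crossed homomorphism of some
  `a ∈ A'`, which is admissible in `ContH1` (so "continuous `H¹` ⊆ discrete `H¹`"; the inclusion
  is in general strict);
* small `ContH1` API: `ContH1.mk_congr`, `mk_mul_mk`, `mk_one`, `mk_eq_mk_iff`.

The Kummer classes are put through this comparison in `EtaleTheta/KummerContH1.lean`.
Universe: `ContH1` is universe-polymorphic; everything touching `groupCohomology.H1` takes `G`,
`G'` in `Type` (Mathlib's multiplicative-cocycle API `IsMulCocycle₁` / `cocyclesOfIsMulCocycle₁`).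
-/

namespace Literature.AnabelianGeometry.EtaleTheta

open groupCohomology

/-! ### Small `ContH1` API -/

section ContH1API

variable {G G' : Type*} [Group G] [TopologicalSpace G]
  [Group G'] [TopologicalSpace G'] [IsTopologicalGroup G']
  {φ : G →* G'} {A' : Subgroup G'} [A'.Normal] [IsMulCommutative A'] (H : Subgroup G)

namespace ContH1

/-- Classes of equal cocycles are equal. [cite: NeukirchSchmidtWingberg2008, I §2 and II §7] -/
theorem mk_congr {f g : H → A'} (hfg : f = g) (hf : f ∈ contCocycles φ A' H)
    (hg : g ∈ contCocycles φ A' H) : ContH1.mk f hf = ContH1.mk g hg := by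
  subst hfg
  rfl

/-- The product of classes is the class of the product. [cite: NeukirchSchmidtWingberg2008, I §2 and II §7] -/
theorem mk_mul_mk (f g : H → A') (hf : f ∈ contCocycles φ A' H) (hg : g ∈ contCocycles φ A' H) :
    ContH1.mk f hf * ContH1.mk g hg = ContH1.mk (f * g) (mul_mem hf hg) := rfl

/-- The class of the trivial cocycle is `1`. [cite: NeukirchSchmidtWingberg2008, I §2 and II §7] -/
theorem mk_one : ContH1.mk (1 : H → A') (one_mem _) = (1 : ContH1 φ A' H) := rfl

/-- Two continuous cocycles define the same class iff they differ by a principal crossed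
homomorphism `h ↦ (φ(h) a φ(h)⁻¹) · a⁻¹`. [cite: NeukirchSchmidtWingberg2008, I §2 and II §7] -/
theorem mk_eq_mk_iff (f g : H → A') (hf : f ∈ contCocycles φ A' H)
    (hg : g ∈ contCocycles φ A' H) :
    ContH1.mk f hf = ContH1.mk g hg ↔
      ∃ a : A', ∀ h : H, (f h)⁻¹ * g h = MulAut.conjNormal (φ (h : G)) a * a⁻¹ := by
  refine (QuotientGroup.eq (s := (contCoboundaries φ A' H).subgroupOf (contCocycles φ A' H))
    (a := ⟨f, hf⟩) (b := ⟨g, hg⟩)).trans ?_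
  rw [Subgroup.mem_subgroupOf, mem_contCoboundaries_iff]
  refine exists_congr fun a => ?_
  rw [funext_iff]
  rfl

end ContH1

end ContH1API

/-! ### The coefficient module and the forgetful map to the discrete `H¹` -/

section ConjCoeff

variable {G G' : Type} [Group G] [Group G'] (φ : G →* G') (A' : Subgroup G') [A'.Normal]

/-- The coefficient group `A'` as an abstract `G`-group, `G` acting by conjugation through `φ` (the
action under which `ContH1 φ A' H` is the continuous `H¹`): a type synonym of `↥A'` carrying this
`MulDistribMulAction`. [cite: NeukirchSchmidtWingberg2008, I §2 and II §7] -/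
def ConjCoeff (_φ : G →* G') (A' : Subgroup G') [A'.Normal] : Type := A'

variable [IsMulCommutative A']

-- Mathlib's scoped `IsMulCommutative` `CommGroup` instance on `↥A'` (same device as `ContH1.lean`).
open scoped IsMulCommutative

namespace ConjCoeff

/-- `ConjCoeff φ A'` is the commutative group `A'` (Mathlib's scoped `IsMulCommutative` instance,
transported to the type synonym). [cite: NeukirchSchmidtWingberg2008, I §2 and II §7] -/
instance instCommGroup : CommGroup (ConjCoeff φ A') := inferInstanceAs (CommGroup A')

/-- `G` acts on `ConjCoeff φ A'` by `g • a = φ(g) a φ(g)⁻¹`.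
[cite: NeukirchSchmidtWingberg2008, I §2 and II §7] -/
instance instMulDistribMulAction : MulDistribMulAction G (ConjCoeff φ A') :=
  MulDistribMulAction.compHom (↥A') ((MulAut.conjNormal : G' →* MulAut A').comp φ)

/-- The identity `A' → ConjCoeff φ A'`. [cite: NeukirchSchmidtWingberg2008, I §2 and II §7] -/
def of : A' ≃* ConjCoeff φ A' := MulEquiv.refl _

/-- The action on `ConjCoeff φ A'` is conjugation via `φ`. [cite: NeukirchSchmidtWingberg2008, I §2 and II §7] -/
@[simp] theorem smul_of (g : G) (x : A') :
    g • of φ A' x = of φ A' (MulAut.conjNormal (φ g) x) := rfl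

end ConjCoeff

end ConjCoeff

section DiscreteH1

variable {G G' : Type} [Group G] [TopologicalSpace G]
  [Group G'] [TopologicalSpace G'] [IsTopologicalGroup G']
  (φ : G →* G') (A' : Subgroup G') [A'.Normal] [IsMulCommutative A'] (H : Subgroup G)

open scoped IsMulCommutative

/-- A continuous crossed homomorphism is in particular a multiplicative `1`-cocycle for the
conjugation module `ConjCoeff φ A'`. [cite: NeukirchSchmidtWingberg2008, I §2 and II §7] -/
theorem isMulCocycle₁_of_mem_contCocycles (f : contCocycles φ A' H) :
    IsMulCocycle₁ (fun h : H => ConjCoeff.of φ A' (f.1 h)) := by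
  intro g h
  change ConjCoeff.of φ A' (f.1 (g * h)) =
    ConjCoeff.of φ A' (MulAut.conjNormal (φ ((g : H) : G)) (f.1 h)) * ConjCoeff.of φ A' (f.1 g)
  rw [f.2.2 g h, ← map_mul (ConjCoeff.of φ A'), mul_comm' (f.1 g)]

/-- **Forgetting continuity**: the homomorphism `[f] ↦ [f]` from the continuous `H¹` (`ContH1 φ A' H`,
multiplicative) to Mathlib's discrete `groupCohomology.H1` of the conjugation module `ConjCoeff φ A'`
(additive). [cite: NeukirchSchmidtWingberg2008, I §2 and II §7] -/
noncomputable def ContH1.toDiscreteH1 :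
    ContH1 φ A' H →* Multiplicative (H1 (Rep.ofMulDistribMulAction H (ConjCoeff φ A'))) :=
  QuotientGroup.lift _
    (MonoidHom.mk'
      (fun f : contCocycles φ A' H => Multiplicative.ofAdd
        (H1π _ (cocyclesOfIsMulCocycle₁ (isMulCocycle₁_of_mem_contCocycles φ A' H f))))
      fun f₁ f₂ => by
        dsimp only
        rw [← ofAdd_add, ← map_add]
        congr 2)
    (by
      rintro f hf
      obtain ⟨a, ha⟩ := (mem_contCoboundaries_iff _).mp (Subgroup.mem_subgroupOf.mp hf)
      rw [MonoidHom.mem_ker, MonoidHom.mk'_apply, ← ofAdd_zero]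
      congr 1
      have hcob : IsMulCoboundary₁ (fun h : H => ConjCoeff.of φ A' (f.1 h)) :=
        ⟨ConjCoeff.of φ A' a, fun h => by
          change ConjCoeff.of φ A' (MulAut.conjNormal (φ ((h : H) : G)) a) / ConjCoeff.of φ A' a =
            ConjCoeff.of φ A' (f.1 h)
          rw [ha, map_mul, map_inv, div_eq_mul_inv]⟩
      exact (H1π_eq_zero_iff _).2 (coboundariesOfIsMulCoboundary₁ hcob).2)

/-- `toDiscreteH1` on the class of a continuous cocycle is the class of the same cocycle.
[cite: NeukirchSchmidtWingberg2008, I §2 and II §7] -/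
theorem ContH1.toDiscreteH1_mk (f : H → A') (hf : f ∈ contCocycles φ A' H) :
    ContH1.toDiscreteH1 φ A' H (ContH1.mk f hf) = Multiplicative.ofAdd
      (H1π _ (cocyclesOfIsMulCocycle₁ (isMulCocycle₁_of_mem_contCocycles φ A' H ⟨f, hf⟩))) :=
  rfl

/-- **In degree one the continuous `H¹` embeds into the discrete `H¹`**: `toDiscreteH1` is
injective — a continuous crossed homomorphism that is a discrete coboundary `h ↦ (φ(h) a φ(h)⁻¹)a⁻¹`
is a principal continuous crossed homomorphism, i.e. trivial in `ContH1`.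
[cite: NeukirchSchmidtWingberg2008, I §2 and II §7] -/
theorem ContH1.toDiscreteH1_injective : Function.Injective (ContH1.toDiscreteH1 φ A' H) := by
  refine (injective_iff_map_eq_one _).2 fun x hx => ?_
  induction x using QuotientGroup.induction_on with
  | H f =>
    change Multiplicative.ofAdd
        (H1π _ (cocyclesOfIsMulCocycle₁ (isMulCocycle₁_of_mem_contCocycles φ A' H f))) =
      Multiplicative.ofAdd 0 at hx
    have h0 := Multiplicative.ofAdd.injective hx
    obtain ⟨x, hx'⟩ := isMulCoboundary₁_of_mem_coboundaries₁ _ ((H1π_eq_zero_iff _).1 h0)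
    refine (QuotientGroup.eq_one_iff _).2 (Subgroup.mem_subgroupOf.2
      ((mem_contCoboundaries_iff _).2 ⟨(ConjCoeff.of φ A').symm x, funext fun h => ?_⟩))
    have hh : h • x / x = ConjCoeff.of φ A' (f.1 h) := hx' h
    apply (ConjCoeff.of φ A').injective
    rw [map_mul, map_inv, ← hh, div_eq_mul_inv]
    rfl

end DiscreteH1

end Literature.AnabelianGeometry.EtaleTheta
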